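import Summits.FinalStateConjecture.FinalStateConjecture.Theorems.SwallowTheDatumUniversalWitnessFamilySheetLine
import Summits.FinalStateConjecture.FinalStateConjecture.Theorems.SwallowTheDatumUniversalWitnessFamilyStubSocketDilation
import Summits.FinalStateConjecture.FinalStateConjecture.Theorems.SwallowTheDatumUniversalWitnessFamilyStubSocketTransportPatch
import Summits.FinalStateConjecture.FinalStateConjecture.Theorems.SwallowTheDatumUniversalWitnessFamilyStubSheetBreathing
import HarnessLib

/-!
# Crux `SwallowTheDatum.UniversalWitnessFamily` (stmt-FinalStateConjecture-10051), line `Sketch` (skeleton v5) —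
# REDUCTION TO THE TWO ANALYTIC ATOMS: `MGHDExists → SubdataDevelopmentsEmbed → farGluing → socketBag → UWF`

Continuation lead c1, 2026-08-16.  With the three geometric stubs of skeleton v5 LANDED
(`stub_socketDilation`, `…StubSocketDilation.lean`; `stub_socketTransportPatch`, `…StubSocketTransportPatch.lean`;
`stub_sheetBreathing`, `…StubSheetBreathing.lean`) and the composition `universalWitnessFamily_of_sheetLine`
(`…SheetLine.lean`), the crux follows from the route items `MGHDExists` (9937) and `SubdataDevelopmentsEmbed` (10053)
and the TWO analytic statements of the line alone:

* FAR GLUING (= crux 10052's registered `stub_farGluing`, verbatim): through every admissible `d`, a family `G R`,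
  jointly smooth on `{R⋆ < R} × X`, of admissible data equal to `d` off `e.far R` and exactly isotropic
  Schwarzschild(`m R ≥ ηR`), `k = 0`, beyond chart radius `32R` of the sole end `e` (Mao–Oh–Tao arXiv:2308.13031
  Thm 1.7/1.10 + smooth dependence on the radius);
* the UNIVERSAL SOCKET BAG (d-free): for every `μ₀ > 0` a datum on `ℝ³` which is vacuum outside the unit ball, exactly
  `((1 + μ/2‖y‖)⁴δ, 0)` on `{1 < ‖y‖ < 2}` for some `0 < μ ≤ μ₀`, and exactly `((1 + M/2‖y‖)⁴δ, 0)` on the open exterior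
  sheet `{‖y‖ > M/2}` for some `M > 4` (Beig–Ó Murchadha near-critical two-puncture blow-up made exact at both weak-field
  junctions by Mao–Oh–Tao Thm 1.7; the combination is not in print — see `Cruxes/UniversalWitnessFamily/Lines/Sketch.md`).

This displays exactly what an unconditional proof of the crux still owes beyond the two route items.  CONDITIONAL; credits
nothing by itself.
-/

-- `Summit.<Summit>.<Problem>` is the tree's mandated summit-side namespace (CONVENTIONS §2); for this
-- single-conjunct summit the two coincide, so the duplicate is deliberate.
set_option linter.dupNamespace false

noncomputable section

namespace Summit.FinalStateConjecture.FinalStateConjecture.Theorems.SwallowTheDatum.UniversalWitnessFamily.SheetLine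

open scoped Manifold ContDiff Topology
open Bundle Set Filter Function Literature.Geometry.Lorentzian
open Summit.FinalStateConjecture.FinalStateConjecture.Theses.SwallowTheDatum
  (UniversalWitnessFamily MGHDExists SubdataDevelopmentsEmbed)
open Summit.FinalStateConjecture.FinalStateConjecture.Theorems.SwallowTheDatum.ParametricKerrBurial
  (SmoothSectionsOn AgreeAt IsExactSchwarzschildBeyond IsSchwarzschildAnnulus VacuumOn IsIsotropicBeyond)

/-- **The crux from the two analytic atoms of line `Sketch` v5** (and the route items `MGHDExists`,
`SubdataDevelopmentsEmbed`): hypotheses = the registered signatures of `stub_farGluing` and `stub_socketBag` verbatim;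
the three geometric stubs are supplied by the landed `stub_socketDilation`, `stub_socketTransportPatch`,
`stub_sheetBreathing`, and the composition by the landed `universalWitnessFamily_of_sheetLine`. [folklore] -/
theorem universalWitnessFamily_of_farGluing_of_socketBag :
    MGHDExists → SubdataDevelopmentsEmbed →
    (∀ (X : Type) [TopologicalSpace X] [ChartedSpace E3 X] [IsManifold (𝓡 3) ∞ X] [T2Space X]
      [SecondCountableTopology X] [ConnectedSpace X], ∀ d ∈ admissibleVacuumData X,
      ∃ (η : ℝ) (e : AFEnd X) (Rstar : ℝ) (m : ℝ → ℝ) (G : ℝ → InitialDataSet (𝓡 3) X),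
        0 < η ∧ e.IsSoleEnd ∧ e.R < Rstar ∧ ContDiff ℝ ∞ m ∧
        SmoothSectionsOn 𝓘(ℝ, ℝ) G {p : ℝ × X | Rstar < p.1} ∧
        ∀ R : ℝ, Rstar < R → G R ∈ admissibleVacuumData X ∧ (∀ x ∉ e.far R, AgreeAt (G R) d x) ∧
          η * R ≤ m R ∧ IsExactSchwarzschildBeyond e (G R) (m R) (32 * R)) →
    (∀ μ₀ : ℝ, 0 < μ₀ → ∃ μ : ℝ, 0 < μ ∧ μ ≤ μ₀ ∧
      ∃ (M : ℝ) (C : InitialDataSet (𝓡 3) E3), 4 < M ∧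
        VacuumOn {y : E3 | 1 < ‖y‖} C ∧ IsSchwarzschildAnnulus C μ ∧ IsIsotropicBeyond M (M / 2) C) →
    UniversalWitnessFamily :=
  fun hM hE hA hU ↦
    universalWitnessFamily_of_sheetLine hM hE hA hU
      Summit.FinalStateConjecture.FinalStateConjecture.Theorems.SwallowTheDatum.UniversalWitnessFamily.stub_socketDilation
      Summit.FinalStateConjecture.FinalStateConjecture.Theorems.SwallowTheDatum.UniversalWitnessFamily.stub_socketTransportPatch
      Summit.FinalStateConjecture.FinalStateConjecture.Theorems.SwallowTheDatum.UniversalWitnessFamily.stub_sheetBreathing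

/-- **The DEEP socket bag implies the socket bag.**  The deep form asks exactness `((1 + M/2‖y‖)⁴δ, 0)` beyond a radius
`R₁` with `2 < R₁`, `40 R₁ < M` — through the throat `‖y‖ = M/2` and on a sheet-2 collar, the depth at which crux 10055's
`PlugData` and the cap engines of the sibling lines read it — and this trivially gives the open-sheet form used by this line
(`M > 80 > 4`, and `{‖y‖ > M/2} ⊆ {‖y‖ > R₁}`).  Recorded so that ONE promoted analytic item (the deep universal socket bag)
serves this crux. [folklore] -/
theorem socketBag_of_socketBagDeep :
    (∀ μ₀ : ℝ, 0 < μ₀ → ∃ μ : ℝ, 0 < μ ∧ μ ≤ μ₀ ∧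
      ∃ (M R₁ : ℝ) (C : InitialDataSet (𝓡 3) E3), 2 < R₁ ∧ 40 * R₁ < M ∧
        VacuumOn {y : E3 | 1 < ‖y‖} C ∧ IsSchwarzschildAnnulus C μ ∧ IsIsotropicBeyond M R₁ C) →
    (∀ μ₀ : ℝ, 0 < μ₀ → ∃ μ : ℝ, 0 < μ ∧ μ ≤ μ₀ ∧
      ∃ (M : ℝ) (C : InitialDataSet (𝓡 3) E3), 4 < M ∧
        VacuumOn {y : E3 | 1 < ‖y‖} C ∧ IsSchwarzschildAnnulus C μ ∧ IsIsotropicBeyond M (M / 2) C) := by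
  intro hdeep μ₀ hμ₀
  obtain ⟨μ, hμ, hμle, M, R₁, C, hR₁, hM, hvac, hann, hiso⟩ := hdeep μ₀ hμ₀
  refine ⟨μ, hμ, hμle, M, C, by linarith, hvac, hann, fun y hy ↦ hiso y ?_⟩
  linarith

/-- **The crux from far gluing and the DEEP universal socket bag** (and the route items `MGHDExists`,
`SubdataDevelopmentsEmbed`): `socketBag_of_socketBagDeep` then `universalWitnessFamily_of_farGluing_of_socketBag`.
This is the form in which the analytic atom should be promoted (it is also what the sibling cruxes' caps need). [folklore] -/
theorem universalWitnessFamily_of_farGluing_of_socketBagDeep :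
    MGHDExists → SubdataDevelopmentsEmbed →
    (∀ (X : Type) [TopologicalSpace X] [ChartedSpace E3 X] [IsManifold (𝓡 3) ∞ X] [T2Space X]
      [SecondCountableTopology X] [ConnectedSpace X], ∀ d ∈ admissibleVacuumData X,
      ∃ (η : ℝ) (e : AFEnd X) (Rstar : ℝ) (m : ℝ → ℝ) (G : ℝ → InitialDataSet (𝓡 3) X),
        0 < η ∧ e.IsSoleEnd ∧ e.R < Rstar ∧ ContDiff ℝ ∞ m ∧
        SmoothSectionsOn 𝓘(ℝ, ℝ) G {p : ℝ × X | Rstar < p.1} ∧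
        ∀ R : ℝ, Rstar < R → G R ∈ admissibleVacuumData X ∧ (∀ x ∉ e.far R, AgreeAt (G R) d x) ∧
          η * R ≤ m R ∧ IsExactSchwarzschildBeyond e (G R) (m R) (32 * R)) →
    (∀ μ₀ : ℝ, 0 < μ₀ → ∃ μ : ℝ, 0 < μ ∧ μ ≤ μ₀ ∧
      ∃ (M R₁ : ℝ) (C : InitialDataSet (𝓡 3) E3), 2 < R₁ ∧ 40 * R₁ < M ∧
        VacuumOn {y : E3 | 1 < ‖y‖} C ∧ IsSchwarzschildAnnulus C μ ∧ IsIsotropicBeyond M R₁ C) →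
    UniversalWitnessFamily :=
  fun hM hE hA hU ↦
    universalWitnessFamily_of_farGluing_of_socketBag hM hE hA (socketBag_of_socketBagDeep hU)

end Summit.FinalStateConjecture.FinalStateConjecture.Theorems.SwallowTheDatum.UniversalWitnessFamily.SheetLine

end
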